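import Summits.ValiantsHypothesis.ValiantsHypothesis.Theses.ValuativeGCT
import Literature.NumberTheory.DiophantineGeometry.SchurWeylPlethysmKroneckerBoundProofs
import Literature.NumberTheory.DiophantineGeometry.SchurWeylPlethysmOrbitWeightsProofs
import Literature.Computability.AlgebraicComplexity.MultiplicityObstructionsProofs
import Literature.Computability.AlgebraicComplexity.PlethysmLifting
import Literature.Computability.AlgebraicComplexity.OrbitCoordinateRingProofs
/-!
# `ValuativeGCT.ValuativeBound` (crux stmt-ValiantsHypothesis-12625) and
# `ValuativeGCT.CoeffVanishingOrder` (support stmt-ValiantsHypothesis-12628) — complete proofs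

Produced by the round-1 crux-triage seat refuter-cruxtri-stmt-ValiantsHypothesis-12625-r1-3-g2
(2026-08-15) as CANDIDATE PROOFS for a prover to land (a refuter cannot propose positive
`Theorems/` files). `lean check`: rc 0, 0 sorry, axioms `propext`, `Classical.choice`, `Quot.sound`.

* Part I (`TriageR1K3`): the Φ-injection line common to the idea cards hwtopoly-* /
  semisimple-lift-exact-rank — glue `range hwToPoly ≤ T ⇒ K_m(λ) ≤ finrank T`, the four clauses of
  the truncation `T` (degree `mδ`; `I(L_U)^(δ(m-r))` via generators-to-powers; Stab-invariance for
  ALL matrices `M` with `M·det = det`; Borel semi-invariance with the character `weightChar χ g`),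
  the semisimple lift of highest-weight classes, and
  `valuativeBound_of_coeffVanishingOrder : CoeffVanishingOrder → ValuativeBound`.
* Part II (`TriageR1K3.CVO`): `coeffVanishingOrder_holds : CoeffVanishingOrder` by the
  projection-mixed-columns line — `det_m(x·A) = det N(x)`, `N = M_U + M_C` along a projection onto
  `U`, column expansion `det (A + B) = Σ_T det mix_T`, mixed determinants with `> r` columns from
  `M_U` vanish (double `MvPolynomial.funext` + rank), the others lie in `(𝔭·S)^(m-r)`, then
  `MvPolynomial.mem_map_C_iff`.
* Part III: `valuativeBound_holds : ValuativeBound`.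

Suggested landing (prover): Part II as `Theorems/ValuativeGCTCoeffVanishingOrder.lean`, Parts I+III
as `Theorems/ValuativeGCTValuativeBound.lean` importing it (each < 400 lines); rename the namespace
to `Summit.ValiantsHypothesis.ValiantsHypothesis.Theorems…` to taste.
-/

open MvPolynomial
open scoped Matrix
open Literature.NumberTheory.DiophantineGeometry Literature.Computability.AlgebraicComplexity

namespace TriageR1K3

noncomputable section

/-! ## Part I — the Φ-injection line (crux modulo stmt-12628) -/


/-- Evaluating an `aeval`-substitution by polynomials = evaluating at the evaluated substitution. -/
theorem eval_aeval_poly {σ' τ : Type*} (A : τ → ℂ) (h : σ' → MvPolynomial τ ℂ) (φ : MvPolynomial σ' ℂ) :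
    eval A (aeval h φ) = eval (fun i => eval A (h i)) φ := by
  rw [aeval_eq_bind₁]
  exact eval₂Hom_bind₁ _ _ _ _

/-- GLUE (shared by the three hwToPoly cards and the semisimple card): an inclusion of the range
of the tree's injection `hwToPoly` into any `T` sitting inside a homogeneous piece bounds the
orbit multiplicity by `finrank T` (no junk: `T` is finite-dimensional). -/
theorem orbitMultiplicity_le_finrank_of_range_le {m : ℕ} (χ : Weight (MatIdx m)) (n : ℕ)
    (T : Submodule ℂ (MvPolynomial (MatIdx m × MatIdx m) ℂ))
    (hT : T ≤ homogeneousSubmodule (MatIdx m × MatIdx m) ℂ n)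
    (hrange : LinearMap.range (hwToPoly (detFormLex ℂ m) m χ) ≤ T) :
    orbitMultiplicity ℂ (detFormLex ℂ m) m χ ≤ Module.finrank ℂ T := by
  haveI : Module.Finite ℂ (homogeneousSubmodule (MatIdx m × MatIdx m) ℂ n) :=
    Literature.Computability.AlgebraicComplexity.finite_homogeneousSubmodule _ _ n
  haveI : Module.Finite ℂ T := Submodule.finiteDimensional_of_le hT
  calc orbitMultiplicity ℂ (detFormLex ℂ m) m χ
        = Module.finrank ℂ (highestWeightSpace (orbitCoordRep (detFormLex ℂ m) m) χ) := rfl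
    _ = Module.finrank ℂ (LinearMap.range (hwToPoly (detFormLex ℂ m) m χ)) :=
        (LinearMap.finrank_range_of_inj (hwToPoly_injective _ _ _)).symm
    _ ≤ Module.finrank ℂ T := Submodule.finrank_mono hrange

/-- `RangeLeTruncation`: the crux body with its conclusion replaced by `range hwToPoly ≤ T`
(T verbatim from the route file). -/
def RangeLeTruncation : Prop :=
  ∀ (m : ℕ) [NeZero m] (U : Submodule ℂ (Literature.NumberTheory.DiophantineGeometry.MatIdx m → ℂ)) (r : ℕ), (∀ u ∈ U, (Matrix.of fun a b : Fin m => u (toLex (a, b))).rank ≤ r) → ∀ (δ : ℕ) (lam : Nat.Partition (m * δ)), lam.parts.card ≤ m * m → let χ : Literature.NumberTheory.DiophantineGeometry.Weight (Literature.NumberTheory.DiophantineGeometry.MatIdx m) := (Literature.NumberTheory.DiophantineGeometry.Weight.dualOfPartition (m * m) lam).toMatIdx; let T : Submodule ℂ (MvPolynomial (Literature.NumberTheory.DiophantineGeometry.MatIdx m × Literature.NumberTheory.DiophantineGeometry.MatIdx m) ℂ) := MvPolynomial.homogeneousSubmodule (Literature.NumberTheory.DiophantineGeometry.MatIdx m ×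 Literature.NumberTheory.DiophantineGeometry.MatIdx m) ℂ (m * δ) ⊓ ((MvPolynomial.vanishingIdeal ℂ {p : Literature.NumberTheory.DiophantineGeometry.MatIdx m × Literature.NumberTheory.DiophantineGeometry.MatIdx m → ℂ | ∀ j : Literature.NumberTheory.DiophantineGeometry.MatIdx m, (fun i => p (j, i)) ∈ U}) ^ (δ * (m - r))).restrictScalars ℂ ⊓ (⨅ (M : Matrix (Literature.NumberTheory.DiophantineGeometry.MatIdx m) (Literature.NumberTheory.DiophantineGeometry.MatIdx m) ℂ) (_ : Literature.Computability.AlgebraicComplexity.linSubst (Literature.NumberTheory.DiophantineGeometry.MatIdx m) ℂ M (Literature.NumberTheory.DiophantineGeometry.detFormLex ℂ m) = Literature.NumberTheory.DiophantineGeometry.detFormLex ℂ m), LinearMap.ker ((MvPolynomial.aeval (R := ℂ) fun p : Literature.NumberTheory.DiophantineGeometry.MatIdx m × Literature.NumberTheory.DiophantineGeometry.MatIdx m => ∑ l : Literature.NumberTheory.DiophantineGeometry.MatIdx m, M l p.2 • MvPolynomial.X (p.1, l)).toLinearMap - LinearMap.id (R := ℂ) (M := MvPolynomial (Literature.NumberTheory.DiophantineGeometry.MatIdx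 m × Literature.NumberTheory.DiophantineGeometry.MatIdx m) ℂ))) ⊓ (⨅ (g : Matrix.GeneralLinearGroup (Literature.NumberTheory.DiophantineGeometry.MatIdx m) ℂ) (_ : Literature.NumberTheory.DiophantineGeometry.IsUpperTriangular g), LinearMap.ker ((MvPolynomial.aeval (R := ℂ) fun p : Literature.NumberTheory.DiophantineGeometry.MatIdx m × Literature.NumberTheory.DiophantineGeometry.MatIdx m => ∑ l : Literature.NumberTheory.DiophantineGeometry.MatIdx m, ((g⁻¹ : Matrix.GeneralLinearGroup (Literature.NumberTheory.DiophantineGeometry.MatIdx m) ℂ) : Matrix (Literature.NumberTheory.DiophantineGeometry.MatIdx m) (Literature.NumberTheory.DiophantineGeometry.MatIdx m) ℂ) p.1 l • MvPolynomial.X (l, p.2)).toLinearMap - Literature.NumberTheory.DiophantineGeometry.weightChar χ g • LinearMap.id (R := ℂ) (M := MvPolynomial (Literature.NumberTheory.DiophantineGeometry.MatIdx m × Literature.NumberTheory.DiophantineGeometry.MatIdx m) ℂ))); LinearMap.range (Literature.NumberTheory.DiophantineGeometry.hwToPoly (Literature.NumberTheory.DiophantineGeometry.detFormLex ℂ m)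 m χ) ≤ T

/-- The reduction every Φ-injection card uses: `RangeLeTruncation → ValuativeBound`. -/
theorem valuativeBound_of_rangeLeTruncation (h : RangeLeTruncation) :
    Summit.ValiantsHypothesis.ValiantsHypothesis.Theses.ValuativeGCT.ValuativeBound := by
  intro m _ U r hU δ lam hlam
  have h' := h m U r hU δ lam hlam
  dsimp only at h' ⊢
  exact orbitMultiplicity_le_finrank_of_range_le _ (m * δ) _
    (fun _ hx => hx.1.1.1) h'

/-- BOREL SIGN (card hwtopoly-density-transport, cheapest falsifier): from the tree lemma
`eval_orbitCoordToPoly_mul_left` alone, `P(g⁻¹ g') = weightChar χ g · P(g')` — the character, not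
its inverse, exactly as T's B-clause is typed. -/
theorem borel_sign {m : ℕ} {F : MvPolynomial (DegIdx (MatIdx m) m) ℂ} {χ : Weight (MatIdx m)}
    (hx : Ideal.Quotient.mk (orbitVanishingIdeal (detFormLex ℂ m) m) F ∈
      highestWeightSpace (orbitCoordRep (detFormLex ℂ m) m) χ)
    {g : GL (MatIdx m) ℂ} (hg : IsUpperTriangular g) (g' : GL (MatIdx m) ℂ) :
    eval (fun ij : MatIdx m × MatIdx m =>
        (((g⁻¹ : GL (MatIdx m) ℂ) : Matrix (MatIdx m) (MatIdx m) ℂ) * (g' : Matrix (MatIdx m) (MatIdx m) ℂ)) ij.1 ij.2)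
        (orbitCoordToPoly (detFormLex ℂ m) m (Ideal.Quotient.mk (orbitVanishingIdeal (detFormLex ℂ m) m) F)) =
      weightChar χ g *
        eval (fun ij : MatIdx m × MatIdx m => (g' : Matrix (MatIdx m) (MatIdx m) ℂ) ij.1 ij.2)
          (orbitCoordToPoly (detFormLex ℂ m) m (Ideal.Quotient.mk (orbitVanishingIdeal (detFormLex ℂ m) m) F)) := by
  have h := eval_orbitCoordToPoly_mul_left (detFormLex ℂ m) m hx ((borelSubgroup _ _).inv_mem hg) g'
  rwa [weightChar_inv χ hg, inv_inv] at h

/-- T's Borel clause as a POLYNOMIAL identity (card hwtopoly-density-transport `BorelClausePoly`,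
card hwtopoly-range-truncation `BorelConjunct`): GL-density (`MvPolynomial.eq_of_eval_eq_on_gl`)
upgrades `borel_sign`. -/
theorem borel_clause_poly {m : ℕ} {F : MvPolynomial (DegIdx (MatIdx m) m) ℂ} {χ : Weight (MatIdx m)}
    (hx : Ideal.Quotient.mk (orbitVanishingIdeal (detFormLex ℂ m) m) F ∈
      highestWeightSpace (orbitCoordRep (detFormLex ℂ m) m) χ)
    {g : GL (MatIdx m) ℂ} (hg : IsUpperTriangular g) :
    aeval (R := ℂ) (fun p : MatIdx m × MatIdx m =>
        ∑ l : MatIdx m, ((g⁻¹ : GL (MatIdx m) ℂ) : Matrix (MatIdx m) (MatIdx m) ℂ) p.1 l • X (l, p.2))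
        (orbitCoordToPoly (detFormLex ℂ m) m (Ideal.Quotient.mk (orbitVanishingIdeal (detFormLex ℂ m) m) F)) =
      weightChar χ g •
        orbitCoordToPoly (detFormLex ℂ m) m (Ideal.Quotient.mk (orbitVanishingIdeal (detFormLex ℂ m) m) F) := by
  apply MvPolynomial.eq_of_eval_eq_on_gl
  intro g'
  have hfun : (fun i : MatIdx m × MatIdx m =>
      eval (fun ij : MatIdx m × MatIdx m => (g' : Matrix (MatIdx m) (MatIdx m) ℂ) ij.1 ij.2)
        (∑ l : MatIdx m, ((g⁻¹ : GL (MatIdx m) ℂ) : Matrix (MatIdx m) (MatIdx m) ℂ) i.1 l • X (l, i.2))) =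
      fun ij => (((g⁻¹ : GL (MatIdx m) ℂ) : Matrix (MatIdx m) (MatIdx m) ℂ) *
        (g' : Matrix (MatIdx m) (MatIdx m) ℂ)) ij.1 ij.2 := by
    funext ij
    simp [Matrix.mul_apply, smul_eval]
  rw [smul_eval, ← borel_sign hx hg g', eval_aeval_poly, hfun]

/-- T's stabiliser clause for EVERY matrix `M` with `M • det = det` (invertible or not), at the
level of `genericOrbitMap` (all hwToPoly cards; card semisimple-lift-exact-rank (5)). -/
theorem stab_clause_poly {m : ℕ} (F : MvPolynomial (DegIdx (MatIdx m) m) ℂ)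
    {M : Matrix (MatIdx m) (MatIdx m) ℂ} (hM : linSubst (MatIdx m) ℂ M (detFormLex ℂ m) = detFormLex ℂ m) :
    aeval (R := ℂ) (fun p : MatIdx m × MatIdx m => ∑ l : MatIdx m, M l p.2 • X (p.1, l))
        (genericOrbitMap (detFormLex ℂ m) m F) = genericOrbitMap (detFormLex ℂ m) m F := by
  apply MvPolynomial.funext
  intro A
  rw [eval_aeval_poly]
  have hA : (fun ij : MatIdx m × MatIdx m => eval A (∑ l : MatIdx m, M l ij.2 • X (ij.1, l))) =
      fun ij => ((Matrix.of fun i j => A (i, j)) * M) ij.1 ij.2 := by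
    funext ij
    simp [Matrix.mul_apply, smul_eval, mul_comm]
  rw [hA, eval_genericOrbitMap, linSubst_mul, AlgHom.comp_apply, hM,
    ← eval_genericOrbitMap]
  rfl

/-- SEMISIMPLE LIFT (card semisimple-lift-exact-rank, first lemma `HighestWeightClassLifts`):
highest-weight CLASSES of `ℂ[Δ_m[f]]` are classes of honest highest-weight VECTORS of `ℂ[Sym^m]`. -/
theorem highestWeightClassLifts {σ : Type} [Fintype σ] [LinearOrder σ] (f : MvPolynomial σ ℂ)
    (m : ℕ) (χ : Weight σ) :
    (highestWeightSpace (coordRep σ ℂ m) χ).map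
        (Ideal.Quotient.mkₐ ℂ (orbitVanishingIdeal f m)).toLinearMap =
      highestWeightSpace (orbitCoordRep f m) χ := by
  let π : (coordRep σ ℂ m).IntertwiningMap (orbitCoordRep f m) :=
    ⟨(Ideal.Quotient.mkₐ ℂ (orbitVanishingIdeal f m)).toLinearMap, fun _ => LinearMap.ext fun _ => rfl⟩
  exact map_highestWeightSpace_eq_of_surjective π (Ideal.Quotient.mkₐ_surjective ℂ _)
    (isSemisimpleRepresentation_coordRep m) χ

/-- EXACT RANK (card semisimple-lift-exact-rank, Transfer `ExactRankFormula`):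
`range hwToPoly = genericOrbitMap (HWV_χ(ℂ[Sym^m]))`. -/
theorem range_hwToPoly_eq {σ : Type} [Fintype σ] [LinearOrder σ] (f : MvPolynomial σ ℂ)
    (m : ℕ) (χ : Weight σ) :
    LinearMap.range (hwToPoly f m χ) =
      (highestWeightSpace (coordRep σ ℂ m) χ).map (genericOrbitMap f m).toLinearMap := by
  ext P
  constructor
  · rintro ⟨x, rfl⟩
    have hx : (x : OrbitCoordRing f m) ∈ (highestWeightSpace (coordRep σ ℂ m) χ).map
        (Ideal.Quotient.mkₐ ℂ (orbitVanishingIdeal f m)).toLinearMap := by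
      rw [highestWeightClassLifts]
      exact x.2
    obtain ⟨F, hF, hFx⟩ := hx
    refine ⟨F, hF, ?_⟩
    rw [hwToPoly_apply, ← hFx]
    exact (orbitCoordToPoly_mk f m F).symm
  · rintro ⟨F, hF, rfl⟩
    have hx : Ideal.Quotient.mk (orbitVanishingIdeal f m) F ∈ highestWeightSpace (orbitCoordRep f m) χ := by
      rw [← highestWeightClassLifts]
      exact ⟨F, hF, rfl⟩
    exact ⟨⟨_, hx⟩, by rw [hwToPoly_apply]; exact orbitCoordToPoly_mk f m F⟩

/-- OrbitMapKernel (support item stmt-12627) is the tree lemma up to unfolding. -/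
theorem orbitMapKernel_holds : Summit.ValiantsHypothesis.ValiantsHypothesis.Theses.ValuativeGCT.OrbitMapKernel := by
  intro m F
  rw [orbitVanishingIdeal_eq_ker_genericOrbitMap, RingHom.mem_ker]
  rfl


/-! ### degree clause T1 -/

/-- T1 (all hwToPoly cards): the image of a weight-`λ*` class is homogeneous of degree `m·δ`;
this is exactly where the crux's guard `lam.parts.card ≤ m*m` is consumed. -/
theorem degree_clause {m δ : ℕ} (lam : Nat.Partition (m * δ)) (hlam : lam.parts.card ≤ m * m)
    {F : MvPolynomial (DegIdx (MatIdx m) m) ℂ}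
    (hx : Ideal.Quotient.mk (orbitVanishingIdeal (detFormLex ℂ m) m) F ∈
      highestWeightSpace (orbitCoordRep (detFormLex ℂ m) m)
        ((Weight.dualOfPartition (m * m) lam).toMatIdx : Weight (MatIdx m))) :
    orbitCoordToPoly (detFormLex ℂ m) m (Ideal.Quotient.mk (orbitVanishingIdeal (detFormLex ℂ m) m) F) ∈
      homogeneousSubmodule (MatIdx m × MatIdx m) ℂ (m * δ) :=
  (mem_homogeneousSubmodule _ _).mpr
    (isHomogeneous_orbitCoordToPoly _ m hx (size_toMatIdx_dualOfPartition m lam hlam))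

/-! ### The common line end to end, conditional on the support item stmt-12628

`CoeffVanishingOrder → ValuativeBound`: lift (§3) + T1 (`degree_clause`) + T2 (generators-to-powers
below + stmt-12628) + T3 (`stab_clause_poly`) + T4 (`borel_clause_poly`) + glue. -/

/-- GeneratorsToPower (cards 3/4/5, T2 glue): an algebra hom sending every variable into an ideal
`J` sends a homogeneous polynomial of degree `δ` into `J ^ δ`. -/
theorem aeval_mem_pow_of_isHomogeneous {ι τ : Type*} (Φ : MvPolynomial ι ℂ →ₐ[ℂ] MvPolynomial τ ℂ)
    (J : Ideal (MvPolynomial τ ℂ)) (hJ : ∀ d, Φ (X d) ∈ J) {F : MvPolynomial ι ℂ} {δ : ℕ}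
    (hF : F.IsHomogeneous δ) : Φ F ∈ J ^ δ := by
  classical
  rw [F.as_sum, map_sum]
  refine Ideal.sum_mem _ fun s hs => ?_
  have hdeg : (∑ d ∈ s.support, s d) = δ := by
    have h := hF (mem_support_iff.mp hs)
    simpa [Finsupp.weight_apply, Finsupp.sum] using h
  rw [monomial_eq, map_mul]
  refine Ideal.mul_mem_left _ _ ?_
  rw [Finsupp.prod, map_prod, ← hdeg, ← Finset.prod_pow_eq_pow_sum]
  refine Ideal.prod_mem_prod fun d _ => ?_
  rw [map_pow]
  exact Ideal.pow_mem_pow (hJ d) _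

/-- **The crux modulo stmt-12628**: `CoeffVanishingOrder → ValuativeBound` (the line of cards
semisimple-lift-exact-rank / hwtopoly-*, re-derived independently in this seat). -/
theorem valuativeBound_of_coeffVanishingOrder
    (hC : Summit.ValiantsHypothesis.ValiantsHypothesis.Theses.ValuativeGCT.CoeffVanishingOrder) :
    Summit.ValiantsHypothesis.ValiantsHypothesis.Theses.ValuativeGCT.ValuativeBound := by
  apply valuativeBound_of_rangeLeTruncation
  intro m _ U r hU δ lam hlam
  dsimp only
  rintro P ⟨x, rfl⟩
  -- lift the class `x` to an honest highest-weight vector `F`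
  have hxmap : (x : OrbitCoordRing (detFormLex ℂ m) m) ∈
      (highestWeightSpace (coordRep (MatIdx m) ℂ m)
          ((Weight.dualOfPartition (m * m) lam).toMatIdx : Weight (MatIdx m))).map
        (Ideal.Quotient.mkₐ ℂ (orbitVanishingIdeal (detFormLex ℂ m) m)).toLinearMap := by
    rw [highestWeightClassLifts]; exact x.2
  obtain ⟨F, hF, hFx⟩ := hxmap
  have hFx' : Ideal.Quotient.mk (orbitVanishingIdeal (detFormLex ℂ m) m) F =
      (x : OrbitCoordRing (detFormLex ℂ m) m) := hFx
  have hxF : Ideal.Quotient.mk (orbitVanishingIdeal (detFormLex ℂ m) m) F ∈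
      highestWeightSpace (orbitCoordRep (detFormLex ℂ m) m)
        ((Weight.dualOfPartition (m * m) lam).toMatIdx : Weight (MatIdx m)) := by
    rw [hFx']; exact x.2
  have hP : hwToPoly (detFormLex ℂ m) m ((Weight.dualOfPartition (m * m) lam).toMatIdx : Weight (MatIdx m)) x =
      genericOrbitMap (detFormLex ℂ m) m F := by
    rw [hwToPoly_apply, ← hFx', orbitCoordToPoly_mk]
  rw [hP]
  -- the four clauses
  have hT1 : genericOrbitMap (detFormLex ℂ m) m F ∈
      homogeneousSubmodule (MatIdx m × MatIdx m) ℂ (m * δ) := by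
    have h := degree_clause lam hlam hxF
    rwa [orbitCoordToPoly_mk] at h
  have hJ : ∀ d : DegIdx (MatIdx m) m, genericOrbitMap (detFormLex ℂ m) m (X d) ∈
      (MvPolynomial.vanishingIdeal ℂ {p : MatIdx m × MatIdx m → ℂ | ∀ j : MatIdx m, (fun i => p (j, i)) ∈ U}) ^ (m - r) :=
    fun d => hC m U r hU d
  have hFhom : F.IsHomogeneous δ :=
    isHomogeneous_of_mem_highestWeightSpace (NeZero.ne m) hF (size_toMatIdx_dualOfPartition m lam hlam)
  have hT2 : genericOrbitMap (detFormLex ℂ m) m F ∈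
      (MvPolynomial.vanishingIdeal ℂ {p : MatIdx m × MatIdx m → ℂ | ∀ j : MatIdx m, (fun i => p (j, i)) ∈ U}) ^ (δ * (m - r)) := by
    have h := aeval_mem_pow_of_isHomogeneous (genericOrbitMap (detFormLex ℂ m) m) _ hJ hFhom
    rwa [← pow_mul, mul_comm] at h
  refine Submodule.mem_inf.mpr ⟨Submodule.mem_inf.mpr ⟨Submodule.mem_inf.mpr ⟨hT1, ?_⟩, ?_⟩, ?_⟩
  · exact hT2
  · simp only [Submodule.mem_iInf, LinearMap.mem_ker, LinearMap.sub_apply, LinearMap.id_apply,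
      AlgHom.toLinearMap_apply, sub_eq_zero]
    intro M hM
    exact stab_clause_poly F hM
  · simp only [Submodule.mem_iInf, LinearMap.mem_ker, LinearMap.sub_apply, LinearMap.smul_apply,
      LinearMap.id_apply, AlgHom.toLinearMap_apply, sub_eq_zero]
    intro g hg
    have h := borel_clause_poly hxF hg
    rwa [orbitCoordToPoly_mk] at h

end

end TriageR1K3

namespace TriageR1K3.CVO

noncomputable section

/-! ## Part II — the support item stmt-12628 (projection-mixed-columns line) -/

/-! ## Generic lemma 1: column expansion of `det (A + B)` over column subsets -/

/-- `det (A + B) = Σ_T det (mix_T)`, where `mix_T` takes column `b` from `A` if `b ∈ T` and from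
`B` otherwise (multilinearity in the columns; Leibniz + `Finset.prod_add`). -/
theorem det_add_eq_sum_det_mix {n : Type*} [Fintype n] [DecidableEq n] {R' : Type*} [CommRing R']
    (A B : Matrix n n R') :
    (A + B).det = ∑ T ∈ (Finset.univ : Finset n).powerset,
      (Matrix.of fun a b => if b ∈ T then A a b else B a b).det := by
  simp only [Matrix.det_apply', Matrix.add_apply, Matrix.of_apply]
  have h1 : ∀ τ : Equiv.Perm n, ∏ i, (A (τ i) i + B (τ i) i) =
      ∑ T ∈ (Finset.univ : Finset n).powerset,
        (∏ i ∈ T, A (τ i) i) * ∏ i ∈ Finset.univ \ T, B (τ i) i :=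
    fun τ => Finset.prod_add _ _ _
  have h2 : ∀ (τ : Equiv.Perm n) (T : Finset n),
      ∏ i, (if i ∈ T then A (τ i) i else B (τ i) i) =
        (∏ i ∈ T, A (τ i) i) * ∏ i ∈ Finset.univ \ T, B (τ i) i := by
    intro τ T
    rw [Finset.prod_ite]
    congr 2
    · ext i; simp
    · ext i; simp [Finset.mem_sdiff]
  simp_rw [h1, h2, Finset.mul_sum]
  exact Finset.sum_comm

/-! ## Generic lemma 2: mixed column determinants with too many columns from a low-rank matrix -/

/-- If `rank Mu ≤ r < |T|` then the matrix taking its `T`-columns from `Mu` (and the others from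
anywhere) is singular. -/
theorem det_mixCols_eq_zero_of_rank_lt {m r : ℕ} (Mu : Matrix (Fin m) (Fin m) ℂ) (hMu : Mu.rank ≤ r)
    (T : Finset (Fin m)) (hT : r < T.card) (w' : Matrix (Fin m) (Fin m) ℂ) :
    (Matrix.of fun a b => if b ∈ T then Mu a b else w' a b).det = 0 := by
  classical
  set g : T → (Fin m → ℂ) := fun b a => Mu a b with hg
  have hdep : ¬ LinearIndependent ℂ g := by
    intro hli
    set M : Submodule ℂ (Fin m → ℂ) := Submodule.span ℂ (Set.range Mu.col) with hM
    have hmem : ∀ b : T, g b ∈ M := fun b => Submodule.subset_span ⟨b, rfl⟩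
    have hli' : LinearIndependent ℂ (fun b : T => (⟨g b, hmem b⟩ : M)) := by
      apply LinearIndependent.of_comp M.subtype
      exact hli
    have hcard := hli'.fintype_card_le_finrank
    rw [Fintype.card_coe, hM, ← Matrix.rank_eq_finrank_span_cols] at hcard
    omega
  obtain ⟨c, hc0, b₀, hb₀⟩ := Fintype.not_linearIndependent_iff.mp hdep
  let v : Fin m → ℂ := fun b => if h : b ∈ T then c ⟨b, h⟩ else 0
  have hv : v ≠ 0 := by
    intro h
    apply hb₀
    have hb := congr_fun h b₀
    simp only [v, Pi.zero_apply] at hb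
    rw [dif_pos b₀.2] at hb
    exact hb
  apply Matrix.exists_mulVec_eq_zero_iff.mp
  refine ⟨v, hv, ?_⟩
  funext a
  have ha := congr_fun hc0 a
  simp only [Finset.sum_apply, Pi.smul_apply, smul_eq_mul, Pi.zero_apply] at ha
  rw [Matrix.mulVec, Pi.zero_apply]
  change ∑ b, (if b ∈ T then Mu a b else w' a b) * v b = 0
  have hsub : ∑ b, (if b ∈ T then Mu a b else w' a b) * v b =
      ∑ b ∈ T, (if b ∈ T then Mu a b else w' a b) * v b := by
    symm
    apply Finset.sum_subset (Finset.subset_univ T)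
    intro b _ hb
    simp only [v, dif_neg hb, mul_zero]
  rw [hsub, ← Finset.sum_coe_sort]
  rw [← ha]
  refine Finset.sum_congr rfl fun b _ => ?_
  simp only [v, if_pos b.2, dif_pos b.2, hg]
  ring


/-! ## The generic matrix of forms and its determinant -/

section Setup

variable (m : ℕ)

/-- `R = ℂ[A]`, coordinate ring of `End W` (variables `A (j, i)`). -/
abbrev R := MvPolynomial (MatIdx m × MatIdx m) ℂ

/-- `S = R[x]`. -/
abbrev S := MvPolynomial (MatIdx m) (R m)

/-- The generic matrix `Agen j i = A (j, i)` (the matrix of stmt-12628). -/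
def Agen : Matrix (MatIdx m) (MatIdx m) (R m) := Matrix.of fun j i => X (j, i)

/-- The generic matrix of forms `N(x) = mat(Σ_j x_j · row_j A)`: entry `(a, b) ↦ Σ_j A(j,(a,b)) · x_j`. -/
def N : Matrix (Fin m) (Fin m) (S m) :=
  Matrix.of fun a b => ∑ j : MatIdx m, C (X (j, toLex (a, b))) * X j

/-- `det_m(x · A) = det N(x)`: the generic substitution of stmt-12628 applied to `det_m` is the
determinant of the generic matrix of forms. -/
theorem linSubst_map_detFormLex :
    linSubst (MatIdx m) (R m) (Agen m) (map C (detFormLex ℂ m)) = (N m).det := by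
  rw [detFormLex, detPoly, AlgHom.map_det, RingHom.map_det, AlgHom.map_det]
  congr 1
  ext a b
  simp [Matrix.map_apply, N, Agen, rename_X, map_X,
    Literature.Computability.AlgebraicComplexity.linSubst_X, smul_eq_C_mul]

variable {m}

/-- The `U`-part coefficient: `uU P j ab = Σ_k P(ab, k) · A(j, k)` (row `j` of `A` pushed through `P`). -/
def uU (P : Matrix (MatIdx m) (MatIdx m) ℂ) (j ab : MatIdx m) : R m :=
  ∑ k : MatIdx m, P ab k • X (j, k)

/-- The complementary coefficient `A(j, ab) - uU P j ab` (row `j` of `A` pushed through `1 - P`). -/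
def uC (P : Matrix (MatIdx m) (MatIdx m) ℂ) (j ab : MatIdx m) : R m :=
  X (j, ab) - uU P j ab

/-- `M_U(x)`. -/
def NU (P : Matrix (MatIdx m) (MatIdx m) ℂ) : Matrix (Fin m) (Fin m) (S m) :=
  Matrix.of fun a b => ∑ j : MatIdx m, C (uU P j (toLex (a, b))) * X j

/-- `M_C(x)`. -/
def NC (P : Matrix (MatIdx m) (MatIdx m) ℂ) : Matrix (Fin m) (Fin m) (S m) :=
  Matrix.of fun a b => ∑ j : MatIdx m, C (uC P j (toLex (a, b))) * X j

/-- `N = M_U + M_C`. -/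
theorem N_eq_add (P : Matrix (MatIdx m) (MatIdx m) ℂ) : N m = NU P + NC P := by
  ext a b
  simp only [N, NU, NC, Matrix.add_apply, Matrix.of_apply, uC, map_sub, sub_mul,
    Finset.sum_sub_distrib]
  ring

/-- The mixed matrix: columns in `T` from `M_U`, the others from `M_C`. -/
def mix (P : Matrix (MatIdx m) (MatIdx m) ℂ) (T : Finset (Fin m)) : Matrix (Fin m) (Fin m) (S m) :=
  Matrix.of fun a b => if b ∈ T then NU P a b else NC P a b

/-- Mixed determinants with more than `r` columns from the `U`-part VANISH identically (double
`MvPolynomial.funext`: at every point the `T`-columns are columns of `mat(P w)`, `P w ∈ U`, of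
rank `≤ r < |T|`). -/
theorem det_mix_eq_zero {r : ℕ} (U : Submodule ℂ (MatIdx m → ℂ))
    (hU : ∀ u ∈ U, (Matrix.of fun a b : Fin m => u (toLex (a, b))).rank ≤ r)
    (P : Matrix (MatIdx m) (MatIdx m) ℂ) (hP : ∀ w : MatIdx m → ℂ, P *ᵥ w ∈ U)
    (T : Finset (Fin m)) (hT : r < T.card) : (mix P T).det = 0 := by
  classical
  apply MvPolynomial.funext
  intro y
  rw [map_zero, RingHom.map_det]
  apply MvPolynomial.funext
  intro A₀
  rw [map_zero, RingHom.map_det]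
  have hentry : ∀ a b : Fin m, eval A₀ (eval y (NU P a b)) =
      (P *ᵥ fun k => ∑ j : MatIdx m, eval A₀ (y j) * A₀ (j, k)) (toLex (a, b)) := by
    intro a b
    simp only [NU, Matrix.of_apply, map_sum, map_mul, eval_C, eval_X, uU, smul_eval,
      Matrix.mulVec, dotProduct, Finset.mul_sum, Finset.sum_mul]
    rw [Finset.sum_comm]
    refine Finset.sum_congr rfl fun k _ => Finset.sum_congr rfl fun j _ => ?_
    ring
  have hmat : (eval A₀).mapMatrix ((eval y).mapMatrix (mix P T)) =
      Matrix.of fun a b => if b ∈ T then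
        (Matrix.of fun a b : Fin m =>
          (P *ᵥ fun k => ∑ j : MatIdx m, eval A₀ (y j) * A₀ (j, k)) (toLex (a, b))) a b
        else eval A₀ (eval y (NC P a b)) := by
    ext a b
    simp only [RingHom.mapMatrix_apply, Matrix.map_apply, mix, Matrix.of_apply]
    split_ifs with hb
    · exact hentry a b
    · rfl
  rw [hmat]
  exact det_mixCols_eq_zero_of_rank_lt _ (hU _ (hP _)) T hT _

/-- Mixed determinants with at most `r` columns from the `U`-part lie in `(𝔭·S)^(m-r)` as soon as
every complementary coefficient `uC` lies in `𝔭` (the `m - |T| ≥ m - r` other columns each carry a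
factor from `𝔭·S`). -/
theorem det_mix_mem {r : ℕ} (𝔭 : Ideal (R m)) (P : Matrix (MatIdx m) (MatIdx m) ℂ)
    (huC : ∀ j ab, uC P j ab ∈ 𝔭) (T : Finset (Fin m)) (hT : T.card ≤ r) :
    (mix P T).det ∈ (Ideal.map (C : R m →+* S m) 𝔭) ^ (m - r) := by
  classical
  have hNC : ∀ a b, NC P a b ∈ Ideal.map (C : R m →+* S m) 𝔭 := by
    intro a b
    simp only [NC, Matrix.of_apply]
    exact Ideal.sum_mem _ fun j _ => Ideal.mul_mem_right _ _ (Ideal.mem_map_of_mem _ (huC j _))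
  rw [Matrix.det_apply']
  refine Ideal.sum_mem _ fun τ _ => Ideal.mul_mem_left _ _ ?_
  have hle : (Ideal.map (C : R m →+* S m) 𝔭) ^ (Tᶜ.card) ≤ (Ideal.map (C : R m →+* S m) 𝔭) ^ (m - r) := by
    apply Ideal.pow_le_pow_right
    rw [Finset.card_compl, Fintype.card_fin]
    omega
  apply hle
  rw [← Finset.prod_mul_prod_compl T]
  refine Ideal.mul_mem_left _ _ ?_
  rw [← Finset.prod_const]
  refine Ideal.prod_mem_prod fun i hi => ?_
  simp only [mix, Matrix.of_apply, if_neg (Finset.mem_compl.mp hi)]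
  exact hNC _ _

end Setup

/-! ## The support item -/

/-- **stmt-ValiantsHypothesis-12628** (`ValuativeGCT.CoeffVanishingOrder`): every coefficient of
`det_m(x · A)` lies in the `(m - r)`-th power of the vanishing ideal of `L_U = {A : rows in U}`
when every matrix of `U` has rank `≤ r` (projection-mixed-columns line). -/
theorem coeffVanishingOrder_holds :
    Summit.ValiantsHypothesis.ValiantsHypothesis.Theses.ValuativeGCT.CoeffVanishingOrder := by
  intro m U r hU d
  classical
  set 𝔭 : Ideal (R m) := MvPolynomial.vanishingIdeal ℂ
    {p : MatIdx m × MatIdx m → ℂ | ∀ j : MatIdx m, (fun i => p (j, i)) ∈ U} with h𝔭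
  obtain ⟨V, hUV⟩ := U.exists_isCompl
  set Pl : (MatIdx m → ℂ) →ₗ[ℂ] (MatIdx m → ℂ) := U.projection V hUV with hPl
  set P : Matrix (MatIdx m) (MatIdx m) ℂ := LinearMap.toMatrix' Pl with hPdef
  have hPmul : ∀ w, P *ᵥ w = Pl w := fun w => by
    rw [hPdef, ← Matrix.toLin'_apply, Matrix.toLin'_toMatrix']
  have hP : ∀ w, P *ᵥ w ∈ U := fun w => by
    rw [hPmul, hPl]
    exact Submodule.projection_apply_mem hUV w
  have hPid : ∀ u ∈ U, P *ᵥ u = u := fun u hu => by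
    rw [hPmul, hPl]
    exact Submodule.projection_apply_left hUV ⟨u, hu⟩
  -- the complementary coefficients vanish on `L_U`
  have huC : ∀ j ab, uC P j ab ∈ 𝔭 := by
    intro j ab
    rw [h𝔭, MvPolynomial.mem_vanishingIdeal_iff]
    intro p hp
    have hrow : P *ᵥ (fun i => p (j, i)) = fun i => p (j, i) := hPid _ (hp j)
    have h := congr_fun hrow ab
    simp only [Matrix.mulVec, dotProduct] at h
    simp only [uC, uU, map_sub, map_sum, map_smul, aeval_X, smul_eq_mul]
    rw [h, sub_self]
  -- the determinant lies in `𝔭^(m-r) · S`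
  have hdet : linSubst (MatIdx m) (R m) (Matrix.of fun j i => X (j, i)) (map C (detFormLex ℂ m)) ∈
      Ideal.map (C : R m →+* S m) (𝔭 ^ (m - r)) := by
    rw [show (Matrix.of fun j i => X (j, i) : Matrix (MatIdx m) (MatIdx m) (R m)) = Agen m from rfl,
      linSubst_map_detFormLex, N_eq_add P, det_add_eq_sum_det_mix, Ideal.map_pow]
    refine Ideal.sum_mem _ fun T _ => ?_
    by_cases hT : r < T.card
    · rw [show (Matrix.of fun a b => if b ∈ T then NU P a b else NC P a b) = mix P T from rfl,
        det_mix_eq_zero U hU P hP T hT]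
      exact Ideal.zero_mem _
    · exact det_mix_mem 𝔭 P huC T (not_lt.mp hT)
  rw [aeval_X]
  exact (mem_map_C_iff.mp hdet) d.1

end

end TriageR1K3.CVO

/-! ## Part III — the crux, unconditionally -/

/-- **Crux stmt-ValiantsHypothesis-12625** (`ValuativeGCT.ValuativeBound`): for every linear space
`U` of `m × m` matrices of rank `≤ r`, every `δ` and every `λ ⊢ mδ` with `≤ m²` parts,
`K_m(λ) = orbitMultiplicity ℂ (detFormLex ℂ m) m λ* ≤ finrank T_U(λ)`. -/
theorem TriageR1K3.valuativeBound_holds :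
    Summit.ValiantsHypothesis.ValiantsHypothesis.Theses.ValuativeGCT.ValuativeBound :=
  TriageR1K3.valuativeBound_of_coeffVanishingOrder TriageR1K3.CVO.coeffVanishingOrder_holds
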